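import Summits.Parity.GeneralizedHardyLittlewood.Theorems.PrimeLevelFamEdgeMomentsBeyondDiagonalDiagRemTwoTwoOuter
import HarnessLib

/-!
# Route `PrimeLevelFamEdge`, crux K_A `MomentsBeyondDiagonal` (stmt-Parity-20007), line «petersson_layers» v4, stub `stub_diag`:
# **the `(c,g)` bookkeeping and the closing arithmetic of the remainder estimates with the log-saving EXPONENT AS A PARAMETER**

Third item of the repair census for rung `N ≥ 3` of `stub_diag` (`Cruxes/MomentsBeyondDiagonal/Lines/petersson_layers_stub_diag_g13_R22.md`,
item 1, «`envelope/per_term/final_arith` with `12 ↦ A`»). The order-`(i,j)` remainder estimate (R_ij) has budget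
`(log q̂)^{i+j−3}` and an inner envelope `Λ^e`, `e = 2(i+j)+4`; with the outer bookkeeping
`Σ_cΣ_g D(cg)²/(cg²) ≤ 3Z₂²(2+log N)` (one log) the log-saving term closes iff the saving exponent `A` satisfies
`A + (i+j−3) ≥ e + 1`. The tree's `…DiagRemTwoTwoOuter.per_term_bound_gen` / `final_arith₂₂` (p831560) have `A = 12`, `e = 12`,
budget `log¹`; this file states both with `A`, `e` and the budget exponent `b` as parameters (`A + b = e + 1`), so that the
assembly of every (R_ij) (next: (R₃₃), `e = 16`, `b = 3`, `A = 14`) is the order-`(2,2)` assembly verbatim: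

* `per_term_bound_gen_pow` — one `(c,g)` term, both threshold regimes, general weight `w`, envelope `E`, saving `(1+log K)^{−A}`;
* `final_arith_pow` — `C·Λ^e·((Z(2+l))²A₁ + 3Z²(2+l)A₂) ≤ C·Z²(16·5^{e+2}C₈ + 6·4^A·5^{e+1})·L^b` from
  `A₁ ≤ 4C₈/(1+L)^{e+3}`, `A₂ ≤ 4^A/L^A`, `A + b = e + 1`, `2 + l ≤ 2Λ`, `1 ≤ Λ ≤ 5L`, `L ≥ 1`.

Def-free; theorems only. Helper `--supports stmt-Parity-20007`; closes nothing; K_A, K_B and the Parity summit are NOT proved;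
nothing about Landau–Siegel zeros.

## References
* E. Kowalski, P. Michel, J. VanderKam, J. reine angew. Math. 526 (2000), Prop. 5.1 p. 18.
  [cite: KowalskiMichelVanderKam2000, Prop. 5.1 — derivation (corner bookkeeping, any power of log)]
-/

noncomputable section

open scoped Real ArithmeticFunction.Moebius
open Finset ArithmeticFunction Real

namespace Summit.Parity.GeneralizedHardyLittlewood.Theorems.MomentsBeyondDiagonal.DiagCorner

open Literature.NumberTheory.LFunctions Literature.NumberTheory.LFunctions.KMV2000
open MollifierMainTerm (W)
open Summit.Parity.GeneralizedHardyLittlewood.Theorems.BeyondDiagonalBeatsQuarter.KernelFormXSq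
  (copTauW divWeight divWeight_nonneg one_le_divWeight abs_W_le)
open Summit.Parity.GeneralizedHardyLittlewood.Theorems.BeyondDiagonalBeatsQuarter.Corner

/-! ### One `(c,g)` term, general weight, general saving exponent -/

/-- **One `(c,g)` term, both threshold regimes, for a general weight `w ≥ 0`, envelope factor `E ≥ 0` and saving exponent `A`**:
if `|F(n,g)| ≤ C·w(n)·(E√(2(g²/Q²)K(M/n)) + E/(1+log K)^A)` for every admissible threshold `K`, then for ANY `K₁`
`|μ(g)·c·(W(cg)²F(cg,g))| ≤ CE·(w(cg)/(cg)·(√(2K₁M)/Q + 2K₁M/Q²) + w(cg)/(cg²)·(1+log K₁)^{−A})`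
(`…DiagRemTwoTwoOuter.per_term_bound_gen` is `A = 12`). [cite: KowalskiMichelVanderKam2000, Prop. 5.1 — derivation (corner bookkeeping)] -/
theorem per_term_bound_gen_pow (A : ℕ) {F : ℕ → ℕ → ℝ} {w : ℕ → ℝ} {C E Q M : ℝ} (hC : 0 ≤ C) (hE : 0 ≤ E)
    (hw : ∀ n, 0 ≤ w n) (hQ : 0 < Q) (hM : 1 ≤ M)
    (hF : ∀ n g : ℕ, n ≠ 0 → g ≠ 0 → (n : ℝ) ≤ M → (g : ℝ) ≤ M → ∀ K : ℕ,
      2 * ((g : ℝ) ^ 2 / Q ^ 2) * K * (M / n) ≤ 1 →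
      |F n g| ≤ C * w n *
        (E * Real.sqrt (2 * ((g : ℝ) ^ 2 / Q ^ 2) * K * (M / n)) + E / (1 + Real.log K) ^ A))
    (K₁ : ℕ) {c g : ℕ} (hc : c ∈ Icc 1 ⌊M⌋₊) (hg : g ∈ Icc 1 (⌊M⌋₊ / c)) :
    |(μ g : ℝ) * c * (W (c * g) ^ 2 * F (c * g) g)| ≤
      C * E * (w (c * g) / ((c : ℝ) * g) * (Real.sqrt (2 * K₁ * M) / Q + 2 * K₁ * M / Q ^ 2) +
        w (c * g) / ((c : ℝ) * g ^ 2) * (1 / (1 + Real.log K₁) ^ A)) := by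
  rw [show (μ g : ℝ) * c * (W (c * g) ^ 2 * F (c * g) g) = (μ g : ℝ) * c * W (c * g) ^ 2 * F (c * g) g by ring]
  have hM0 : 0 < M := by linarith
  set N : ℕ := ⌊M⌋₊ with hNdef
  have hNM : (N : ℝ) ≤ M := Nat.floor_le hM0.le
  have hc1 := (Finset.mem_Icc.1 hc).1
  have hg1 := (Finset.mem_Icc.1 hg).1
  have hc0 : (0 : ℝ) < c := by exact_mod_cast hc1
  have hgr : (0 : ℝ) < g := by exact_mod_cast hg1
  have hc1r : (1 : ℝ) ≤ c := by exact_mod_cast hc1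
  have hg1r : (1 : ℝ) ≤ g := by exact_mod_cast hg1
  have hcg0 : c * g ≠ 0 := by positivity
  have hnN : c * g ≤ N := by
    have := (Finset.mem_Icc.1 hg).2
    calc c * g ≤ c * (N / c) := Nat.mul_le_mul_left c this
      _ ≤ N := Nat.mul_div_le N c
  have hnM : ((c * g : ℕ) : ℝ) ≤ M := le_trans (by exact_mod_cast hnN) hNM
  have hgN : g ≤ N := (Finset.mem_Icc.1 hg).2.trans (Nat.div_le_self N c)
  have hgM : (g : ℝ) ≤ M := le_trans (by exact_mod_cast hgN) hNM
  have hD := hw (c * g)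
  have hK0 : (0 : ℝ) ≤ K₁ := Nat.cast_nonneg _
  have hlogK : 0 ≤ Real.log (K₁ : ℝ) := Real.log_natCast_nonneg K₁
  have hLam10 : 0 ≤ E := hE
  -- the atoms `u = 1/(cg)`, `v = 1/(cg²)`, `S₁ = √(2K₁M)/Q`, `L₁ = 2K₁M/Q²`, `T = (1+log K₁)⁻¹²`
  set u : ℝ := 1 / ((c : ℝ) * g) with hu
  set v : ℝ := 1 / ((c : ℝ) * g ^ 2) with hv
  set S₁ : ℝ := Real.sqrt (2 * K₁ * M) / Q with hS₁
  set L₁ : ℝ := 2 * K₁ * M / Q ^ 2 with hL₁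
  set T : ℝ := 1 / (1 + Real.log (K₁ : ℝ)) ^ A with hT
  have hu0 : 0 ≤ u := by positivity
  have hv0 : 0 ≤ v := by positivity
  have hS0 : 0 ≤ S₁ := by positivity
  have hL0 : 0 ≤ L₁ := by positivity
  have hT0 : 0 ≤ T := by positivity
  have huv : v * g = u := by rw [hu, hv]; field_simp
  have hvu : v ≤ u := by
    rw [← huv]
    have : v * 1 ≤ v * g := mul_le_mul_of_nonneg_left hg1r hv0
    linarith
  rw [div_eq_mul_one_div (w (c * g)) ((c : ℝ) * g), div_eq_mul_one_div (w (c * g)) ((c : ℝ) * g ^ 2)]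
  -- |μ g · c · W(n)²| ≤ v
  have hW : W (c * g) ^ 2 ≤ (((c * g : ℕ) : ℝ))⁻¹ ^ 2 := by
    rw [← sq_abs]; exact pow_le_pow_left₀ (abs_nonneg _) (abs_W_le (c * g)) 2
  have hμ : |(μ g : ℝ)| ≤ 1 := by exact_mod_cast ArithmeticFunction.abs_moebius_le_one
  have hcoef : |(μ g : ℝ) * c * W (c * g) ^ 2| ≤ v := by
    rw [abs_mul, abs_mul, abs_of_pos hc0, abs_of_nonneg (sq_nonneg (W (c * g)))]
    calc |(μ g : ℝ)| * c * W (c * g) ^ 2 ≤ 1 * c * (((c * g : ℕ) : ℝ))⁻¹ ^ 2 := by gcongr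
      _ = v := by rw [hv]; push_cast; field_simp
  rw [abs_mul]
  by_cases hA : 2 * ((g : ℝ) ^ 2 / Q ^ 2) * K₁ * (M / ((c * g : ℕ) : ℝ)) ≤ 1
  · -- regime A: threshold K₁
    have h := hF (c * g) g hcg0 (by omega) hnM hgM K₁ hA
    have hsqrt : Real.sqrt (2 * ((g : ℝ) ^ 2 / Q ^ 2) * K₁ * (M / ((c * g : ℕ) : ℝ))) ≤ g * S₁ := by
      have h1 : 2 * ((g : ℝ) ^ 2 / Q ^ 2) * K₁ * (M / ((c * g : ℕ) : ℝ)) ≤ (g * S₁) ^ 2 := by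
        rw [hS₁, mul_pow, div_pow, Real.sq_sqrt (by positivity)]
        have e : 2 * ((g : ℝ) ^ 2 / Q ^ 2) * K₁ * (M / ((c * g : ℕ) : ℝ)) =
            (g : ℝ) ^ 2 * (2 * K₁ * M / Q ^ 2) * u := by
          rw [hu]; push_cast; field_simp
        rw [e]
        have hu1 : u ≤ 1 := by
          rw [hu, div_le_one (by positivity)]; nlinarith
        have : 0 ≤ (g : ℝ) ^ 2 * (2 * K₁ * M / Q ^ 2) := by positivity
        nlinarith
      calc _ ≤ Real.sqrt ((g * S₁) ^ 2) := Real.sqrt_le_sqrt h1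
        _ = g * S₁ := Real.sqrt_sq (by positivity)
    have h' : |F (c * g) g| ≤ C * w (c * g) * (E * (g * S₁ + T)) := by
      refine h.trans (mul_le_mul_of_nonneg_left ?_ (by positivity))
      rw [div_eq_mul_one_div (E)]
      calc E * Real.sqrt (2 * ((g : ℝ) ^ 2 / Q ^ 2) * K₁ * (M / ((c * g : ℕ) : ℝ))) + E * T
          ≤ E * (g * S₁) + E * T := by gcongr
        _ = E * (g * S₁ + T) := by ring
    calc |(μ g : ℝ) * c * W (c * g) ^ 2| * |F (c * g) g|
        ≤ v * (C * w (c * g) * (E * (g * S₁ + T))) := mul_le_mul hcoef h' (abs_nonneg _) hv0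
      _ = C * E * (w (c * g) * (v * g) * S₁ + w (c * g) * v * T) := by ring
      _ = C * E * (w (c * g) * u * S₁ + w (c * g) * v * T) := by rw [huv]
      _ ≤ C * E * (w (c * g) * u * (S₁ + L₁) + w (c * g) * v * T) := by
          gcongr
          exact le_add_of_nonneg_right hL0
  · -- regime B: threshold 0; `1/g < 2K₁M/(cQ²) ≤ 2K₁M/Q²`
    rw [not_le] at hA
    have h := hF (c * g) g hcg0 (by omega) hnM hgM 0 (by simp)
    simp only [Nat.cast_zero, mul_zero, zero_mul, Real.sqrt_zero, Real.log_zero, add_zero, one_pow, div_one,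
      zero_add] at h
    -- `v ≤ u · L₁`
    have hA' : 1 < L₁ * ((g : ℝ) / c) := by
      have e : 2 * ((g : ℝ) ^ 2 / Q ^ 2) * K₁ * (M / ((c * g : ℕ) : ℝ)) = L₁ * ((g : ℝ) / c) := by
        rw [hL₁]; push_cast; field_simp
      exact lt_of_lt_of_eq hA e
    have hgc : (g : ℝ) / c ≤ g := div_le_self hgr.le hc1r
    have h1 : 1 ≤ L₁ * g := by
      have := mul_le_mul_of_nonneg_left hgc hL0
      linarith
    have hginv : v ≤ u * L₁ := by
      rw [← huv]
      have : v * 1 ≤ v * (L₁ * g) := mul_le_mul_of_nonneg_left h1 hv0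
      linarith
    calc |(μ g : ℝ) * c * W (c * g) ^ 2| * |F (c * g) g|
        ≤ v * (C * w (c * g) * E) := mul_le_mul hcoef h (abs_nonneg _) hv0
      _ = C * E * w (c * g) * v := by ring
      _ ≤ C * E * w (c * g) * (u * L₁) := mul_le_mul_of_nonneg_left hginv (by positivity)
      _ ≤ C * E * (w (c * g) * u * (S₁ + L₁) + w (c * g) * v * T) := by
          have e : C * E * w (c * g) * (u * L₁) = C * E * (w (c * g) * u * L₁) := by ring
          rw [e]
          apply mul_le_mul_of_nonneg_left _ (by positivity)
          linarith [mul_nonneg (mul_nonneg hD hu0) hS0, mul_nonneg (mul_nonneg hD hv0) hT0]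

/-! ### The closing arithmetic, general exponents -/

/-- The closing arithmetic of (R_ij) with parameters: `CΛ^e((Z(2+l))²A₁ + 3Z²(2+l)A₂) ≤ C·Z²(16·5^{e+2}C₈ + 6·4^A·5^{e+1})·L^b`
from `A₁ ≤ 4C₈/(1+L)^{e+3}`, `A₂ ≤ 4^A/L^A`, `A + b = e + 1`, `2 + l ≤ 2Λ`, `1 ≤ Λ ≤ 5L`, `L ≥ 1`
(`…DiagRemTwoTwoOuter.final_arith₂₂` is `e = A = 12`, `b = 1`). [folklore] -/
theorem final_arith_pow {e A b : ℕ} (hAb : A + b = e + 1) {C C₈ Z L Lam l A₁ A₂ : ℝ} (hC : 0 ≤ C) (hC₈ : 0 ≤ C₈)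
    (hL : 1 ≤ L) (hLam1 : 1 ≤ Lam) (hLam : Lam ≤ 5 * L) (hl : 0 ≤ l) (hlLam : 2 + l ≤ 2 * Lam) (hA₁0 : 0 ≤ A₁)
    (hA₁ : A₁ ≤ 4 * C₈ / (1 + L) ^ (e + 3)) (hA₂0 : 0 ≤ A₂) (hA₂ : A₂ ≤ 4 ^ A / L ^ A) :
    C * Lam ^ e * ((Z * (2 + l)) ^ 2 * A₁ + 3 * Z ^ 2 * (2 + l) * A₂) ≤
      C * (Z ^ 2 * (16 * 5 ^ (e + 2) * C₈ + 6 * 4 ^ A * 5 ^ (e + 1))) * L ^ b := by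
  have hL0 : 0 < L := by linarith
  have hLam0 : 0 ≤ Lam := by linarith
  have hLb : 1 ≤ L ^ b := one_le_pow₀ hL
  have h2l : (2 + l) ^ 2 ≤ (2 * Lam) ^ 2 := pow_le_pow_left₀ (by linarith) hlLam 2
  have hΛe2 : Lam ^ (e + 2) ≤ (5 * L) ^ (e + 2) := pow_le_pow_left₀ hLam0 hLam (e + 2)
  have hΛe1 : Lam ^ (e + 1) ≤ (5 * L) ^ (e + 1) := pow_le_pow_left₀ hLam0 hLam (e + 1)
  have h1L : L ^ (e + 3) ≤ (1 + L) ^ (e + 3) := pow_le_pow_left₀ hL0.le (by linarith) (e + 3)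
  have hinvL : 1 / L ≤ L ^ b := by
    rw [div_le_iff₀ hL0]
    nlinarith [hLb]
  have hZ2 : 0 ≤ Z ^ 2 := sq_nonneg Z
  -- first piece
  have p1 : Lam ^ e * ((Z * (2 + l)) ^ 2 * A₁) ≤ Z ^ 2 * (16 * 5 ^ (e + 2) * C₈) * L ^ b := by
    calc Lam ^ e * ((Z * (2 + l)) ^ 2 * A₁) = Lam ^ e * (Z ^ 2 * (2 + l) ^ 2 * A₁) := by ring
      _ ≤ Lam ^ e * (Z ^ 2 * (2 * Lam) ^ 2 * (4 * C₈ / (1 + L) ^ (e + 3))) := by gcongr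
      _ = Z ^ 2 * (16 * C₈) * Lam ^ (e + 2) / (1 + L) ^ (e + 3) := by ring
      _ ≤ Z ^ 2 * (16 * C₈) * (5 * L) ^ (e + 2) / L ^ (e + 3) := by gcongr
      _ = Z ^ 2 * (16 * 5 ^ (e + 2) * C₈) * (1 / L) := by
          rw [mul_pow, pow_succ L (e + 2)]
          field_simp
      _ ≤ Z ^ 2 * (16 * 5 ^ (e + 2) * C₈) * L ^ b := by gcongr
  -- second piece
  have hLpow : L ^ (e + 1) = L ^ A * L ^ b := by rw [← pow_add, hAb]
  have p2 : Lam ^ e * (3 * Z ^ 2 * (2 + l) * A₂) ≤ Z ^ 2 * (6 * 4 ^ A * 5 ^ (e + 1)) * L ^ b := by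
    calc Lam ^ e * (3 * Z ^ 2 * (2 + l) * A₂) ≤ Lam ^ e * (3 * Z ^ 2 * (2 * Lam) * (4 ^ A / L ^ A)) := by gcongr
      _ = Z ^ 2 * (6 * 4 ^ A) * Lam ^ (e + 1) / L ^ A := by ring
      _ ≤ Z ^ 2 * (6 * 4 ^ A) * (5 * L) ^ (e + 1) / L ^ A := by gcongr
      _ = Z ^ 2 * (6 * 4 ^ A * 5 ^ (e + 1)) * L ^ b := by
          rw [mul_pow, hLpow]
          field_simp
  calc C * Lam ^ e * ((Z * (2 + l)) ^ 2 * A₁ + 3 * Z ^ 2 * (2 + l) * A₂)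
      = C * (Lam ^ e * ((Z * (2 + l)) ^ 2 * A₁) + Lam ^ e * (3 * Z ^ 2 * (2 + l) * A₂)) := by ring
    _ ≤ C * (Z ^ 2 * (16 * 5 ^ (e + 2) * C₈) * L ^ b + Z ^ 2 * (6 * 4 ^ A * 5 ^ (e + 1)) * L ^ b) := by gcongr
    _ = C * (Z ^ 2 * (16 * 5 ^ (e + 2) * C₈ + 6 * 4 ^ A * 5 ^ (e + 1))) * L ^ b := by ring

/-- Sanity check: the parametric closing arithmetic at `e = A = 12`, `b = 1` is the order-`(2,2)` one (up to `L¹ = L`). -/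
example {C C₈ Z L Lam l A₁ A₂ : ℝ} (hC : 0 ≤ C) (hC₈ : 0 ≤ C₈)
    (hL : 1 ≤ L) (hLam1 : 1 ≤ Lam) (hLam : Lam ≤ 5 * L) (hl : 0 ≤ l) (hlLam : 2 + l ≤ 2 * Lam) (hA₁0 : 0 ≤ A₁)
    (hA₁ : A₁ ≤ 4 * C₈ / (1 + L) ^ 15) (hA₂0 : 0 ≤ A₂) (hA₂ : A₂ ≤ 4 ^ 12 / L ^ 12) :
    C * Lam ^ 12 * ((Z * (2 + l)) ^ 2 * A₁ + 3 * Z ^ 2 * (2 + l) * A₂) ≤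
      C * (Z ^ 2 * (16 * 5 ^ 14 * C₈ + 6 * 4 ^ 12 * 5 ^ 13)) * L ^ 1 :=
  final_arith_pow (e := 12) (A := 12) (b := 1) rfl hC hC₈ hL hLam1 hLam hl hlLam hA₁0 hA₁ hA₂0 hA₂

end Summit.Parity.GeneralizedHardyLittlewood.Theorems.MomentsBeyondDiagonal.DiagCorner

end
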